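import Literature.NumberTheory.Automorphic.AdelicUnitaryGroupDatum
import Literature.NumberTheory.Automorphic.UnitaryGroupLocalCongr
import Literature.NumberTheory.Automorphic.UnitaryGroupNonsplitPlaceModel
import Literature.NumberTheory.Automorphic.QuadraticLocalBaseChange
import HarnessLib

/-!
# Local congruence transport for unitary groups: `U(H)(F_v) ≃ₜ* U(H')(F_v)` from a LOCAL similitude, and at
# every split place (Platonov–Rapinchuk 1994 §2.3, §5.1; Mok 2015 §1)

Topic `NumberTheory/Automorphic`; namespace `Literature.NumberTheory.Automorphic.UnitaryGroup`.  Definitions (REAL: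
explicit isomorphisms of topological groups) and proved lemmas only: **no named fact, no `sorry`**, imports = tree.

**Setting** — that of `UnitaryGroupAutomorphicRep` ∕ `UnitaryGroupLocalFactors` ∕ `UnitaryGroupSplitPlace`: `E/F`
number fields, `c : E ≃ₐ[F] E`, `N : ℕ`, matrices `J, J' ∈ M_N(E)`, a finite place `v` of `F`,
`E_v := E ⊗_F F_v = Π_{w ∣ v} E_w` (`UnitaryGroup.LocalRing E v`) with its conjugation `c ⊗ 1 = conjLocal E c v`, and
the LOCAL unitary group `U(J)(F_v) = UnitaryGroup.«local» E c N J v ≤ GL_N(E_v)` — the carrier of the `Local v` field of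
the tree's adelic group data `UnitaryGroup.adelicGroupData F E c N J` and, in the CM case `F = L⁺`, `E = L`,
`c = complexConj L`, of `UnitaryGroup.cmDatum L N H` (`cmDatum_Local`, `rfl`).

The tree already has the GLOBAL∕RATIONAL congruence transports (★ `unitaryGroupCongr`, `adelicUnitaryGroupCongr`,
`finAdelicCongr`, and place by place ★ `UnitaryGroup.localCongr … v` for a RATIONAL similitude `B ∈ GL_N(E)`), the
split-place frame ★ `localSplitEquiv : U(J)(F_v) ≃ₜ* GL_N(E_w)` (`J` hermitian, invertible at `w`, `c • w ≠ w`) and the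
non-split one-place criterion ★ `mem_localPi_iff_of_smul_eq`.  This file adds the two LOCAL statements the
quasi-split comparison `G′_v ≅ G_v` of an inner form needs ([Rogawski1990, §14.2]: «`G′_v` is isomorphic to `G_v` if
`v` is finite», for `D = M₃(E)`), in the tree's carriers:

* §1 **local change of basis** (`localFormCongr`): for a similitude OVER `E_v`, `T ∈ GL_N(E_v)` and a unit `a ∈ E_v^×`
  with `ᵗ((c ⊗ 1) T) · J_v · T = a • J'_v` (`J_v := J ⊗ 1 ∈ M_N(E_v)`), conjugation `g ↦ T g T⁻¹` is an isomorphism of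
  topological groups `U(J')(F_v) ≃ₜ* U(J)(F_v)` (★ `conj_mem_unitaryGroupOfForm_iff` + ★ `unitaryGroupOfForm_smul_of_isUnit`;
  no condition on `a` beyond being a unit — `U(a • J') = U(J')`);
* §2 **split places** (`localSplitCongr`): at a place `v` of `F` that splits in `E` (`w ∣ v`, `c • w ≠ w`), ANY two
  hermitian matrices `J, J'` invertible at `w` have isomorphic local unitary groups, `U(J)(F_v) ≃ₜ* GL_N(E_w) ≃ₜ* U(J')(F_v)`
  (two uses of ★ `localSplitEquiv`), the `w`-components being matched (`localSplitEquiv_localSplitCongr`);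
* §3 **non-split places** (`localGLPiEvalEquiv`, `localNonsplitEquiv`, `localNonsplitCongr`): for `c • w = w` (one place
  above `v`, ★ `PlacesOver.eq_of_smul_eq`) the one-place model `U(J)(F_v) ≃ₜ* U(σ_w, J_w)(E_w)` as an isomorphism of
  TOPOLOGICAL groups (★ `exists_mulEquiv_localPi_of_smul_eq` is the bare `≃*`), `σ_w = galAdicCompletionMap c hw`,
  `J_w = placeForm J w`, and the transport of a similitude over the FIELD `E_w`, `ᵗ(σ_w T) · J_w · T = a • J'_w`, to
  `U(J')(F_v) ≃ₜ* U(J)(F_v)`;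
* §4 **the CM packaging** (`F = L⁺`, `E = L`, `c = complexConj L`; carriers `(cmDatum L N H).Local v`): Mok's split
  form `Φ_N = antidiag(1,…,1)` written as the literal matrix `of (fun i j => if i+j+1 = N then 1 else 0)` IS
  ★ `(StdForm.antidiagonal N).over L` (`antidiagOne_eq_over`), hence hermitian and invertible; `cmDatumLocalCongr`,
  `cmDatumLocalSplitCongr`, `cmDatumLocalNonsplitCongr` (the three transports in `cmDatum` currency); and the reduction
  **`nonempty_cmDatum_local_equiv_of_forall_nonsplit`**: for hermitian invertible `H, H'`, if the local groups are
  isomorphic at every NON-SPLIT place then they are isomorphic at EVERY finite place — with the anisotropic∕`Φ_N`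
  specialisation `nonempty_cmDatum_local_equiv_antidiag_of_forall_nonsplit` in the binders of the quasi-split
  comparison (anisotropic `H` is invertible by ★ `Godement.det_ne_zero_of_anisotropic`).

What is NOT here (the other half of the local comparison): the classification of hermitian forms over a local
quadratic FIELD extension in odd rank (`H_w ≃ a • Φ_N`, [Jacobowitz1962, Thm. 3.1]) — the input of §3∕§4 at the
non-split places.

## References
* V. Platonov, A. Rapinchuk, *Algebraic Groups and Number Theory* (1994), §2.3 (equivalent hermitian forms have
  conjugate unitary groups), §5.1 (`G_{F_v}` of a matrix realisation) [PlatonovRapinchuk1994].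
* C. P. Mok, *Endoscopic classification of representations of quasi-split unitary groups*, Mem. AMS 235 (2015), §1
  Notation p. 5 (`U(N)(F_v) ≅ GL_N(F_v)` at split `v`; the form `J_N`) [Mok2014].
* J. Rogawski, *Automorphic Representations of Unitary Groups in Three Variables*, Ann. of Math. Stud. 123 (1990),
  §14.2 p. 232 (print) [Rogawski1990].
-/

noncomputable section

open NumberField IsDedekindDomain
open Literature.AlgebraicGeometry.ShimuraVarieties (hermForm)
open scoped Matrix MatrixGroups

namespace Literature.NumberTheory.Automorphic

namespace UnitaryGroup

section Generic

variable {F E : Type} [Field F] [NumberField F] [Field E] [NumberField E] [Algebra F E]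
  (c : E ≃ₐ[F] E) {N : ℕ}

/-! ## §1 Local change of basis over `E_v = E ⊗_F F_v` -/

/-- The local unitary group is the unitary group of `J` read over `E_v`:
`U(J)(F_v) = U(c ⊗ 1, J ⊗ 1)(E_v)` (★ `adelicForm_map_adeleToLocal`). [cite: PlatonovRapinchuk1994, §5.1] -/
theorem local_eq_unitaryGroupOfForm_map (J : Matrix (Fin N) (Fin N) E) (v : HeightOneSpectrum (𝓞 F)) :
    «local» E c N J v = unitaryGroupOfForm (conjLocal E c v) (J.map (algebraMap E (LocalRing E v))) := by
  rw [← adelicForm_map_adeleToLocal]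
  rfl

/-- **Local change of basis, membership form**: for a similitude over `E_v`, `ᵗ((c ⊗ 1) T) · J_v · T = a • J'_v` with
`a` a unit, `g ∈ U(J')(F_v) ↔ T g T⁻¹ ∈ U(J)(F_v)`. [cite: PlatonovRapinchuk1994, §2.3] -/
theorem conj_mem_local_iff_of_formCongr (v : HeightOneSpectrum (𝓞 F)) (T : GL (Fin N) (LocalRing E v))
    {a : LocalRing E v} (ha : IsUnit a) {J J' : Matrix (Fin N) (Fin N) E}
    (h : formCongr (conjLocal E c v) T (J.map (algebraMap E (LocalRing E v))) =
      a • J'.map (algebraMap E (LocalRing E v)))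
    (g : GL (Fin N) (LocalRing E v)) : g ∈ «local» E c N J' v ↔ T * g * T⁻¹ ∈ «local» E c N J v := by
  rw [local_eq_unitaryGroupOfForm_map, local_eq_unitaryGroupOfForm_map, conj_mem_unitaryGroupOfForm_iff, h,
    unitaryGroupOfForm_smul_of_isUnit _ ha]

/-- **`U(J')(F_v) ≃ₜ* U(J)(F_v)`, `g ↦ T g T⁻¹`, for a LOCAL similitude `ᵗ((c ⊗ 1) T) · J_v · T = a • J'_v`**
(`T ∈ GL_N(E_v)`, `a ∈ E_v^×`): equivalent-up-to-a-unit hermitian forms over `E_v` have conjugate local unitary groups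
(Platonov–Rapinchuk §2.3; the place-`v` statement with a local, not rational, change of basis — the datum the local
comparison `G′_v ≅ G_v` of an inner form is made of). [cite: PlatonovRapinchuk1994, §2.3] -/
def localFormCongr (v : HeightOneSpectrum (𝓞 F)) (T : GL (Fin N) (LocalRing E v)) {a : LocalRing E v} (ha : IsUnit a)
    {J J' : Matrix (Fin N) (Fin N) E}
    (h : formCongr (conjLocal E c v) T (J.map (algebraMap E (LocalRing E v))) =
      a • J'.map (algebraMap E (LocalRing E v))) :
    «local» E c N J' v ≃ₜ* «local» E c N J v :=
  ContinuousMulEquiv.restrictSubgroup (GLn.conjEquiv T) _ _ (conj_mem_local_iff_of_formCongr c v T ha h)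

/-- `localFormCongr` on underlying matrices: `T g T⁻¹`. [cite: PlatonovRapinchuk1994, §2.3] -/
@[simp] theorem coe_localFormCongr_apply (v : HeightOneSpectrum (𝓞 F)) (T : GL (Fin N) (LocalRing E v))
    {a : LocalRing E v} (ha : IsUnit a) {J J' : Matrix (Fin N) (Fin N) E}
    (h : formCongr (conjLocal E c v) T (J.map (algebraMap E (LocalRing E v))) =
      a • J'.map (algebraMap E (LocalRing E v))) (g : «local» E c N J' v) :
    ((localFormCongr c v T ha h g : «local» E c N J v) : GL (Fin N) (LocalRing E v)) = T * g * T⁻¹ := rfl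

/-- `localFormCongr.symm` on underlying matrices: `T⁻¹ g T`. [cite: PlatonovRapinchuk1994, §2.3] -/
@[simp] theorem coe_localFormCongr_symm_apply (v : HeightOneSpectrum (𝓞 F)) (T : GL (Fin N) (LocalRing E v))
    {a : LocalRing E v} (ha : IsUnit a) {J J' : Matrix (Fin N) (Fin N) E}
    (h : formCongr (conjLocal E c v) T (J.map (algebraMap E (LocalRing E v))) =
      a • J'.map (algebraMap E (LocalRing E v))) (g : «local» E c N J v) :
    (((localFormCongr c v T ha h).symm g : «local» E c N J' v) : GL (Fin N) (LocalRing E v)) = T⁻¹ * g * T := rfl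

/-! ## §2 Split places: any two invertible hermitian forms have isomorphic local unitary groups -/

section Split

variable [Algebra.IsQuadraticExtension F E] {J J' : Matrix (Fin N) (Fin N) E} {v : HeightOneSpectrum (𝓞 F)}

/-- **At a split place all local unitary groups are `GL_N(E_w)`**: for `w ∣ v` with `c • w ≠ w` and `J, J'` hermitian,
invertible at `w`, the composite `U(J)(F_v) ≃ₜ* GL_N(E_w) ≃ₜ* U(J')(F_v)` of the split frames ★ `localSplitEquiv`
(Mok §1: «for `v` split `U(N)(F_v) ≅ GL_N(F_v)`», whatever the form). [cite: Mok2014, §1 Notation p. 5] -/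
def localSplitCongr (hc : c ≠ 1) (hJ : (J.map c)ᵀ = J) (hJ' : (J'.map c)ᵀ = J') (w : PlacesOver E v)
    (hw : c • w.1 ≠ w.1) (hJw : IsUnit (placeForm J w.1)) (hJ'w : IsUnit (placeForm J' w.1)) :
    «local» E c N J v ≃ₜ* «local» E c N J' v :=
  (localSplitEquiv c J hc hJ w hw hJw).trans (localSplitEquiv c J' hc hJ' w hw hJ'w).symm

/-- `localSplitCongr` matches the `w`-components: `(localSplitCongr g)_w = g_w` in `GL_N(E_w)`. [cite: Mok2014, §1 Notation p. 5] -/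
@[simp] theorem localSplitEquiv_localSplitCongr (hc : c ≠ 1) (hJ : (J.map c)ᵀ = J) (hJ' : (J'.map c)ᵀ = J')
    (w : PlacesOver E v) (hw : c • w.1 ≠ w.1) (hJw : IsUnit (placeForm J w.1)) (hJ'w : IsUnit (placeForm J' w.1))
    (g : «local» E c N J v) :
    localSplitEquiv c J' hc hJ' w hw hJ'w (localSplitCongr c hc hJ hJ' w hw hJw hJ'w g) = localSplitEquiv c J hc hJ w hw hJw g :=
  (localSplitEquiv c J' hc hJ' w hw hJ'w).apply_symm_apply _

/-- `J` invertible in `M_N(E)` (`IsUnit J.det`) is invertible at every place (★ `isUnit_placeForm`). [cite: PlatonovRapinchuk1994, §5.1] -/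
theorem isUnit_placeForm_of_isUnit_det (hJ : IsUnit J.det) (w : HeightOneSpectrum (𝓞 E)) : IsUnit (placeForm J w) :=
  isUnit_placeForm J ((Matrix.isUnit_iff_isUnit_det J).2 hJ) w

end Split

/-! ## §3 Non-split places: the topological one-place model and transport of a similitude over `E_w` -/

section Nonsplit

variable [Algebra.IsQuadraticExtension F E] {v : HeightOneSpectrum (𝓞 F)}

/-- At a non-split place (`c • w = w`, so `w` is the only place above `v`), evaluation at `w` is an isomorphism of
topological groups `Π_{w' ∣ v} GL_N(E_{w'}) ≃ₜ* GL_N(E_w)` (Mathlib `MulEquiv.piUnique` ∕ `Homeomorph.piUnique` at the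
`Unique` structure with default `w`). [cite: CasselsFrohlichANT1967, Ch. II §10] -/
def localGLPiEvalEquiv (N : ℕ) (hc : c ≠ 1) (w : PlacesOver E v) (hw : c • w.1 = w.1) :
    LocalGLPi E N v ≃ₜ* GL (Fin N) (w.1.adicCompletion E) :=
  letI : Unique (PlacesOver E v) :=
    @uniqueOfSubsingleton _ (PlacesOver.subsingleton_of_smul_eq c hc w hw) w
  { MulEquiv.piUnique (fun w' : PlacesOver E v => GL (Fin N) (w'.1.adicCompletion E)) with
    continuous_toFun := continuous_apply w
    continuous_invFun := (Homeomorph.piUnique (fun w' : PlacesOver E v => GL (Fin N) (w'.1.adicCompletion E))).symm.continuous }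

/-- `localGLPiEvalEquiv u = u_w`. [cite: CasselsFrohlichANT1967, Ch. II §10] -/
@[simp] theorem localGLPiEvalEquiv_apply (N : ℕ) (hc : c ≠ 1) (w : PlacesOver E v) (hw : c • w.1 = w.1)
    (u : LocalGLPi E N v) : localGLPiEvalEquiv c N hc w hw u = u w := rfl

/-- `(localGLPiEvalEquiv.symm g)_w = g`. [cite: CasselsFrohlichANT1967, Ch. II §10] -/
@[simp] theorem localGLPiEvalEquiv_symm_apply_self (N : ℕ) (hc : c ≠ 1) (w : PlacesOver E v) (hw : c • w.1 = w.1)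
    (g : GL (Fin N) (w.1.adicCompletion E)) : (localGLPiEvalEquiv c N hc w hw).symm g w = g :=
  (localGLPiEvalEquiv c N hc w hw).apply_symm_apply g

variable (J : Matrix (Fin N) (Fin N) E)

/-- Membership transport for the one-place model: `u ∈ U(J)(F_v) ↔ u_w ∈ U(σ_w, J_w)(E_w)` (★ `mem_localPi_iff_of_smul_eq`).
[cite: PlatonovRapinchuk1994, §5.1] -/
theorem mem_localPi_iff_eval_mem (hc : c ≠ 1) (w : PlacesOver E v) (hw : c • w.1 = w.1) (u : LocalGLPi E N v) :
    u ∈ localPi E c N J v ↔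
      localGLPiEvalEquiv c N hc w hw u ∈ unitaryGroupOfForm (galAdicCompletionMap (L := E) c hw) (placeForm J w.1) := by
  rw [mem_localPi_iff_of_smul_eq c N J hc w hw, localGLPiEvalEquiv_apply, mem_unitaryGroupOfForm_iff]

/-- **The one-place model as an isomorphism of TOPOLOGICAL groups** (factor form): at a non-split place,
`U(J)(F_v) ≃ₜ* U(σ_w, J_w)(E_w)`, `u ↦ u_w`, with `σ_w = galAdicCompletionMap c hw` the conjugation of the local
quadratic field extension `E_w ⊃ F_v` and `J_w = placeForm J w` (`E ⊗_F F_v = E_w`). [cite: PlatonovRapinchuk1994, §5.1] -/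
def localPiNonsplitEquiv (hc : c ≠ 1) (w : PlacesOver E v) (hw : c • w.1 = w.1) :
    localPi E c N J v ≃ₜ* unitaryGroupOfForm (galAdicCompletionMap (L := E) c hw) (placeForm J w.1) :=
  ContinuousMulEquiv.restrictSubgroup (localGLPiEvalEquiv c N hc w hw) _ _ (mem_localPi_iff_eval_mem c J hc w hw)

/-- `localPiNonsplitEquiv u = u_w` on underlying matrices. [cite: PlatonovRapinchuk1994, §5.1] -/
@[simp] theorem coe_localPiNonsplitEquiv_apply (hc : c ≠ 1) (w : PlacesOver E v) (hw : c • w.1 = w.1)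
    (u : localPi E c N J v) :
    ((localPiNonsplitEquiv c J hc w hw u : unitaryGroupOfForm (galAdicCompletionMap (L := E) c hw) (placeForm J w.1)) :
      GL (Fin N) (w.1.adicCompletion E)) = (u : LocalGLPi E N v) w := rfl

/-- **The one-place model, matrix form**: `U(J)(F_v) = «local» E c N J v ≃ₜ* U(σ_w, J_w)(E_w)` (through ★ `localPiEquiv`).
[cite: PlatonovRapinchuk1994, §5.1] -/
def localNonsplitEquiv (hc : c ≠ 1) (w : PlacesOver E v) (hw : c • w.1 = w.1) :
    «local» E c N J v ≃ₜ* unitaryGroupOfForm (galAdicCompletionMap (L := E) c hw) (placeForm J w.1) :=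
  (localPiEquiv E c N J v).symm.trans (localPiNonsplitEquiv c J hc w hw)

variable {J} {J' : Matrix (Fin N) (Fin N) E}

/-- **Transport of a similitude over the local FIELD `E_w` at a non-split place**: for `T ∈ GL_N(E_w)` and a unit
`a ∈ E_w^×` with `ᵗ(σ_w T) · J_w · T = a • J'_w`, `U(J')(F_v) ≃ₜ* U(J)(F_v)` — one-place models on both sides and
★ `unitaryGroupOfFormCongr` in `GL_N(E_w)` (the shape in which a local classification of hermitian forms over the
quadratic extension `E_w ⊃ F_v` is consumed). [cite: PlatonovRapinchuk1994, §2.3] -/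
def localNonsplitCongr (hc : c ≠ 1) (w : PlacesOver E v) (hw : c • w.1 = w.1) (T : GL (Fin N) (w.1.adicCompletion E))
    {a : w.1.adicCompletion E} (ha : IsUnit a)
    (h : formCongr (galAdicCompletionMap (L := E) c hw) T (placeForm J w.1) = a • placeForm J' w.1) :
    «local» E c N J' v ≃ₜ* «local» E c N J v :=
  ((localNonsplitEquiv c J' hc w hw).trans
    (ContinuousMulEquiv.restrictSubgroup (GLn.conjEquiv T)
      (unitaryGroupOfForm (galAdicCompletionMap (L := E) c hw) (placeForm J' w.1))
      (unitaryGroupOfForm (galAdicCompletionMap (L := E) c hw) (placeForm J w.1)) fun g => by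
        rw [GLn.conjEquiv_apply, conj_mem_unitaryGroupOfForm_iff, h, unitaryGroupOfForm_smul_of_isUnit _ ha])).trans
    (localNonsplitEquiv c J hc w hw).symm

/-- `localNonsplitCongr` in the one-place models: `(localNonsplitCongr g)_w = T · g_w · T⁻¹`. [cite: PlatonovRapinchuk1994, §2.3] -/
theorem localNonsplitEquiv_localNonsplitCongr (hc : c ≠ 1) (w : PlacesOver E v) (hw : c • w.1 = w.1)
    (T : GL (Fin N) (w.1.adicCompletion E)) {a : w.1.adicCompletion E} (ha : IsUnit a)
    (h : formCongr (galAdicCompletionMap (L := E) c hw) T (placeForm J w.1) = a • placeForm J' w.1)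
    (g : «local» E c N J' v) :
    ((localNonsplitEquiv c J hc w hw (localNonsplitCongr c hc w hw T ha h g) :
        unitaryGroupOfForm (galAdicCompletionMap (L := E) c hw) (placeForm J w.1)) : GL (Fin N) (w.1.adicCompletion E)) =
      T * ((localNonsplitEquiv c J' hc w hw g : unitaryGroupOfForm (galAdicCompletionMap (L := E) c hw) (placeForm J' w.1)) :
        GL (Fin N) (w.1.adicCompletion E)) * T⁻¹ := by
  unfold localNonsplitCongr
  rw [ContinuousMulEquiv.trans_apply, ContinuousMulEquiv.trans_apply, ContinuousMulEquiv.apply_symm_apply]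
  rfl

end Nonsplit

end Generic

/-! ## §4 The CM packaging: `F = L⁺`, `E = L`, `c` = complex conjugation, carriers `(cmDatum L N H).Local v` -/

section CM

variable (L : Type) [Field L] [NumberField L] [IsCMField L] (N : ℕ)

omit [NumberField L] [IsCMField L] in
/-- Mok's split form `Φ_N = antidiag(1, …, 1)` written as the literal matrix `(i, j) ↦ [i + j + 1 = N]` IS the tree's
`(StdForm.antidiagonal N).over L` (`j = rev i ↔ i + j + 1 = N`). [cite: Mok2014, §1 Notation p. 5] -/
theorem antidiagOne_eq_over :
    (Matrix.of fun i j : Fin N => if i.val + j.val + 1 = N then (1 : L) else 0) = (StdForm.antidiagonal N).over L := by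
  ext i j
  have hiff : i.val + j.val + 1 = N ↔ j = i.rev := by
    rw [Fin.ext_iff, Fin.val_rev]
    omega
  simp only [StdForm.over, Matrix.map_apply, StdForm.antidiagonal_J_apply, Matrix.of_apply]
  by_cases hij : j = i.rev
  · rw [if_pos (hiff.2 hij), if_pos hij, map_one]
  · rw [if_neg (fun h' => hij (hiff.1 h')), if_neg hij, map_zero]

/-- `Φ_N` is hermitian for the CM conjugation (its entries are `0, 1`). [cite: Mok2014, §1 Notation p. 5] -/
theorem antidiagOne_isHermitian :
    ((Matrix.of fun i j : Fin N => if i.val + j.val + 1 = N then (1 : L) else 0).map (cmConjRingHom L))ᵀ =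
      Matrix.of fun i j : Fin N => if i.val + j.val + 1 = N then (1 : L) else 0 := by
  rw [antidiagOne_eq_over, StdForm.over_map, StdForm.transpose_over]

omit [NumberField L] [IsCMField L] in
/-- `Φ_N` is invertible (`Φ_N² = 1`). [cite: Mok2014, §1 Notation p. 5] -/
theorem isUnit_antidiagOne_det :
    IsUnit (Matrix.of fun i j : Fin N => if i.val + j.val + 1 = N then (1 : L) else 0).det := by
  rw [antidiagOne_eq_over, ← Matrix.isUnit_iff_isUnit_det]
  exact StdForm.isUnit_over _ L

variable {N}

/-- The two spellings of «hermitian for the CM conjugation» agree: `cmConjRingHom L` IS `complexConj L` entrywise.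
[cite: Mok2014, §1 Notation p. 5] -/
theorem map_cmConjRingHom_eq_map_complexConj (H : Matrix (Fin N) (Fin N) L) :
    H.map (cmConjRingHom L) = H.map (IsCMField.complexConj L) := rfl

/-- **CM local change of basis**: for `T ∈ GL_N(L ⊗ L⁺_v)` and a unit `a` with `ᵗ(T̄) · H_v · T = a • H'_v`, conjugation by
`T` is `U(H')(L⁺_v) ≃ₜ* U(H)(L⁺_v)` on the carriers `(cmDatum L N ·).Local v` (= §1 `localFormCongr`; `cmDatum_Local` is `rfl`).
[cite: PlatonovRapinchuk1994, §2.3] -/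
def cmDatumLocalCongr {H H' : Matrix (Fin N) (Fin N) L} (v : HeightOneSpectrum (𝓞 ↥(maximalRealSubfield L)))
    (T : GL (Fin N) (LocalRing L v)) {a : LocalRing L v} (ha : IsUnit a)
    (h : formCongr (conjLocal L (IsCMField.complexConj L) v) T (H.map (algebraMap L (LocalRing L v))) =
      a • H'.map (algebraMap L (LocalRing L v))) :
    (cmDatum L N H').Local v ≃ₜ* (cmDatum L N H).Local v :=
  localFormCongr (IsCMField.complexConj L) v T ha h

/-- `cmDatumLocalCongr` on underlying matrices: `T g T⁻¹`. [cite: PlatonovRapinchuk1994, §2.3] -/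
@[simp] theorem coe_cmDatumLocalCongr_apply {H H' : Matrix (Fin N) (Fin N) L}
    (v : HeightOneSpectrum (𝓞 ↥(maximalRealSubfield L))) (T : GL (Fin N) (LocalRing L v)) {a : LocalRing L v}
    (ha : IsUnit a)
    (h : formCongr (conjLocal L (IsCMField.complexConj L) v) T (H.map (algebraMap L (LocalRing L v))) =
      a • H'.map (algebraMap L (LocalRing L v))) (g : (cmDatum L N H').Local v) :
    ((cmDatumLocalCongr L v T ha h g).val : GL (Fin N) (LocalRing L v)) = T * g.val * T⁻¹ := rfl

/-- **CM split places**: at a place `v` of `L⁺` split in `L` (`w ∣ v`, `w̄ ≠ w`), any two hermitian `H, H'` with invertible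
determinant have `U(H)(L⁺_v) ≃ₜ* U(H')(L⁺_v)` (§2 `localSplitCongr`; both are `GL_N(L_w)`). [cite: Mok2014, §1 Notation p. 5] -/
def cmDatumLocalSplitCongr {H H' : Matrix (Fin N) (Fin N) L} (hH : (H.map (cmConjRingHom L))ᵀ = H) (hHd : IsUnit H.det)
    (hH' : (H'.map (cmConjRingHom L))ᵀ = H') (hH'd : IsUnit H'.det) {v : HeightOneSpectrum (𝓞 ↥(maximalRealSubfield L))}
    (w : PlacesOver L v) (hw : IsCMField.complexConj L • w.1 ≠ w.1) :
    (cmDatum L N H).Local v ≃ₜ* (cmDatum L N H').Local v :=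
  localSplitCongr (IsCMField.complexConj L) (IsCMField.complexConj_ne_one L)
    ((map_cmConjRingHom_eq_map_complexConj L H) ▸ hH) ((map_cmConjRingHom_eq_map_complexConj L H') ▸ hH') w hw
    (isUnit_placeForm_of_isUnit_det hHd w.1) (isUnit_placeForm_of_isUnit_det hH'd w.1)

/-- **CM non-split places**: for `w ∣ v` with `w̄ = w`, a similitude over the local field `L_w`, `ᵗ(σ_w T) · H_w · T = a • H'_w`
(`a` a unit), gives `U(H')(L⁺_v) ≃ₜ* U(H)(L⁺_v)` (§3 `localNonsplitCongr`). [cite: PlatonovRapinchuk1994, §2.3] -/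
def cmDatumLocalNonsplitCongr {H H' : Matrix (Fin N) (Fin N) L} {v : HeightOneSpectrum (𝓞 ↥(maximalRealSubfield L))}
    (w : PlacesOver L v) (hw : IsCMField.complexConj L • w.1 = w.1) (T : GL (Fin N) (w.1.adicCompletion L))
    {a : w.1.adicCompletion L} (ha : IsUnit a)
    (h : formCongr (galAdicCompletionMap (L := L) (IsCMField.complexConj L) hw) T (placeForm H w.1) = a • placeForm H' w.1) :
    (cmDatum L N H').Local v ≃ₜ* (cmDatum L N H).Local v :=
  localNonsplitCongr (IsCMField.complexConj L) (IsCMField.complexConj_ne_one L) w hw T ha h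

/-- **Reduction to the non-split places.**  For hermitian `H, H'` with invertible determinants: if at every NON-SPLIT
finite place `v` of `L⁺` (`w ∣ v`, `w̄ = w`) the local unitary groups are isomorphic, then they are isomorphic at EVERY
finite place (the split places are free by `cmDatumLocalSplitCongr`; every `v` has a place `w` above it,
★ `PlacesOver.nonempty`). [cite: Rogawski1990, §14.2 p. 232] -/
theorem nonempty_cmDatum_local_equiv_of_forall_nonsplit {H H' : Matrix (Fin N) (Fin N) L}
    (hH : (H.map (cmConjRingHom L))ᵀ = H) (hHd : IsUnit H.det) (hH' : (H'.map (cmConjRingHom L))ᵀ = H') (hH'd : IsUnit H'.det)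
    (hns : ∀ (v : HeightOneSpectrum (𝓞 ↥(maximalRealSubfield L))) (w : PlacesOver L v),
      IsCMField.complexConj L • w.1 = w.1 → Nonempty ((cmDatum L N H).Local v ≃ₜ* (cmDatum L N H').Local v))
    (v : HeightOneSpectrum (𝓞 ↥(maximalRealSubfield L))) :
    Nonempty ((cmDatum L N H).Local v ≃ₜ* (cmDatum L N H').Local v) := by
  obtain ⟨w⟩ : Nonempty (PlacesOver L v) := inferInstance
  by_cases hw : IsCMField.complexConj L • w.1 = w.1
  · exact hns v w hw
  · exact ⟨cmDatumLocalSplitCongr L hH hHd hH' hH'd w hw⟩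

/-- The same reduction with the non-split input in SIMILITUDE form over `L ⊗ L⁺_v`: at each non-split `v` a local change
of basis `ᵗ(T̄) · H'_v · T = a • H_v` (`a` a unit) — the output shape of a local classification of hermitian forms.
[cite: PlatonovRapinchuk1994, §2.3] -/
theorem nonempty_cmDatum_local_equiv_of_forall_nonsplit_formCongr {H H' : Matrix (Fin N) (Fin N) L}
    (hH : (H.map (cmConjRingHom L))ᵀ = H) (hHd : IsUnit H.det) (hH' : (H'.map (cmConjRingHom L))ᵀ = H') (hH'd : IsUnit H'.det)
    (hns : ∀ (v : HeightOneSpectrum (𝓞 ↥(maximalRealSubfield L))) (w : PlacesOver L v),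
      IsCMField.complexConj L • w.1 = w.1 →
        ∃ (T : GL (Fin N) (LocalRing L v)) (a : LocalRing L v), IsUnit a ∧
          formCongr (conjLocal L (IsCMField.complexConj L) v) T (H'.map (algebraMap L (LocalRing L v))) =
            a • H.map (algebraMap L (LocalRing L v)))
    (v : HeightOneSpectrum (𝓞 ↥(maximalRealSubfield L))) :
    Nonempty ((cmDatum L N H).Local v ≃ₜ* (cmDatum L N H').Local v) :=
  nonempty_cmDatum_local_equiv_of_forall_nonsplit L hH hHd hH' hH'd
    (fun v w hw => by
      obtain ⟨T, a, ha, h⟩ := hns v w hw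
      exact ⟨cmDatumLocalCongr L v T ha h⟩) v

/-- **The quasi-split comparison at the finite places, reduced to the non-split places** — in the binders of the
comparison `G′_v ≅ G_v` for the inner form `G′ = U(H)`, `H` ANISOTROPIC hermitian of rank `N`, against the quasi-split
`G = U(Φ_N)`, `Φ_N = antidiag(1, …, 1)` ([Rogawski1990, §14.2]: for `D = M_N(E)` the set `S` is empty, so `G′_v ≅ G_v` at
every finite `v`): anisotropic ⇒ `det H ≠ 0` (★ `Godement.det_ne_zero_of_anisotropic`), `Φ_N` is hermitian and invertible
(`antidiagOne_isHermitian`, `isUnit_antidiagOne_det`), the split places are free (§2), and what remains is an isomorphism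
at each non-split place. [cite: Rogawski1990, §14.2 p. 232] -/
theorem nonempty_cmDatum_local_equiv_antidiag_of_forall_nonsplit (H : Matrix (Fin N) (Fin N) L)
    (hanis : ∀ x : Fin N → L, hermForm (cmConjRingHom L) H x x = 0 → x = 0) (hH : (H.map (cmConjRingHom L))ᵀ = H)
    (hns : ∀ (v : HeightOneSpectrum (𝓞 ↥(maximalRealSubfield L))) (w : PlacesOver L v),
      IsCMField.complexConj L • w.1 = w.1 →
        Nonempty ((cmDatum L N H).Local v ≃ₜ*
          (cmDatum L N (Matrix.of fun i j : Fin N => if i.val + j.val + 1 = N then (1 : L) else 0)).Local v))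
    (v : HeightOneSpectrum (𝓞 ↥(maximalRealSubfield L))) :
    Nonempty ((cmDatum L N H).Local v ≃ₜ*
      (cmDatum L N (Matrix.of fun i j : Fin N => if i.val + j.val + 1 = N then (1 : L) else 0)).Local v) :=
  nonempty_cmDatum_local_equiv_of_forall_nonsplit L hH (isUnit_iff_ne_zero.2 (Godement.det_ne_zero_of_anisotropic L H hanis))
    (antidiagOne_isHermitian L N) (isUnit_antidiagOne_det L N) hns v

/-- The same, with the non-split input as a LOCAL SIMILITUDE `ᵗ(T̄) · H_v · T = a • (Φ_N)_v` over `L ⊗ L⁺_v` (`T ∈ GL_N(L ⊗ L⁺_v)`,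
`a` a unit) — the odd-rank local classification «`H_v ≃ a • Φ_N`» in the tree's carriers; the isomorphism at such a `v` is
`(cmDatumLocalCongr L v T ha h).symm`, `g ↦ T⁻¹ g T`. [cite: Rogawski1990, §14.2 p. 232] [cite: PlatonovRapinchuk1994, §2.3] -/
theorem nonempty_cmDatum_local_equiv_antidiag_of_forall_nonsplit_formCongr (H : Matrix (Fin N) (Fin N) L)
    (hanis : ∀ x : Fin N → L, hermForm (cmConjRingHom L) H x x = 0 → x = 0) (hH : (H.map (cmConjRingHom L))ᵀ = H)
    (hns : ∀ (v : HeightOneSpectrum (𝓞 ↥(maximalRealSubfield L))) (w : PlacesOver L v),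
      IsCMField.complexConj L • w.1 = w.1 →
        ∃ (T : GL (Fin N) (LocalRing L v)) (a : LocalRing L v), IsUnit a ∧
          formCongr (conjLocal L (IsCMField.complexConj L) v) T (H.map (algebraMap L (LocalRing L v))) =
            a • (Matrix.of fun i j : Fin N => if i.val + j.val + 1 = N then (1 : L) else 0).map (algebraMap L (LocalRing L v)))
    (v : HeightOneSpectrum (𝓞 ↥(maximalRealSubfield L))) :
    Nonempty ((cmDatum L N H).Local v ≃ₜ*
      (cmDatum L N (Matrix.of fun i j : Fin N => if i.val + j.val + 1 = N then (1 : L) else 0)).Local v) :=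
  nonempty_cmDatum_local_equiv_antidiag_of_forall_nonsplit L H hanis hH
    (fun v w hw => by
      obtain ⟨T, a, ha, h⟩ := hns v w hw
      exact ⟨(cmDatumLocalCongr L v T ha h).symm⟩) v

end CM

end UnitaryGroup

end Literature.NumberTheory.Automorphic

end
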